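import Summits.AtomisticToContinuum.Crystallization.Theorems.ReggeStarCoercivityDefectFreeCrystallizesPalmDefs
import Summits.AtomisticToContinuum.Crystallization.Theorems.PalmUnimodularRigidityPalmToHinge
import Summits.AtomisticToContinuum.Crystallization.Theorems.PalmUnimodularRigidityCruxesToPalmRigidity
import Literature.Probability.Process.PointStationaryLaw

/-!
# `stub_chargeFromFunnelLaw` — R3 of line `palm-good-law`, route β (crux stmt-AtomisticToContinuum-13603, `ReggeStarCoercivity.DefectFreeCrystallizes`)

Route β of the line (lead c3, skeleton v13) reads the crux as
`GoodLawOfZeroDefects` (P1, landed) + FUNNEL LAW RIGIDITY (= crux 9227 at tolerance `1/20` ∘ crux 9226 at tolerance `1/20`)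
+ this charging step ⇒ `GroundStatesChargePeriodic` ⇒ (items 2916 + `LennardJonesMinimalDistance_holds`) the crux.

**Statement.** `GoodLawOfZeroDefects → FunnelLawRigidity → (every LJ ground-state sequence has defect fraction → 0) →
GroundStatesChargePeriodic`, where FunnelLawRigidity (stated inline) says: a minimising (`E_P[h] ≤ e*`) point-stationary
`δ`-hard-core probability law almost surely carried by configurations all of whose points are `SetGood` is almost surely an exact
rotated relaxed hcp crystal `count|A(hcpStacking a h)`, `(a, h) ∈ [1/2, 2]²`, `e(hcp a h) = e*` (the conclusion of crux 9226 verbatim).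

**Proof** — the landed `stub_chargeFromLaw` (P5, p119089) minus its shell step: the good limit law of the sequence is minimising
(`CrysEnergyLimit_holds` + uniqueness of limits), its last clause is exactly the funnel hypothesis, so funnel law rigidity makes it
a.s. an exact hcp crystal; then verbatim the end of `palmToHinge_proof`: a support point `(a₀, h₀)` of the parameter law
(`exists_mem_forall_nhds_measure_ne_zero`), `Q := hcpPeriodicConfiguration a₀ h₀` with base point `0`, nearby parameters give
`(R, ε)`-matched crystals (`matched_hcp_of_matched_near`), and the density-transfer clause charges `≥ ρ N` particles eventually
along `φ`, hence frequently in `N`.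
-/

noncomputable section

open scoped ENNReal
open Filter Topology MeasureTheory Set

namespace Summit.AtomisticToContinuum.Crystallization.Theorems.PalmGoodLaw.ChargeFromFunnelLaw

open Summit.AtomisticToContinuum.Crystallization.Theses
open Summit.AtomisticToContinuum.Crystallization.Theorems.PalmUnimodularRigidity
open Literature.MathematicalPhysics.StatisticalMechanics Literature.Geometry.DiscreteGeometry
open Literature.Probability.Process

/-- **R3 `stub_chargeFromFunnelLaw` of line `palm-good-law`, route β (crux stmt-AtomisticToContinuum-13603).**  CHARGING ONE PERIODIC
CONFIGURATION FROM THE FUNNEL LAW: under the crux's antecedent, the good limit law of a ground-state sequence (P1) is minimising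
(`CrysEnergyLimit_holds`), a.s. everywhere `SetGood` (its last clause), hence a.s. an exact rotated relaxed hcp crystal by funnel law
rigidity; a support point `(a₀, h₀)` of the parameter law, `matched_hcp_of_matched_near` and the density-transfer clause of P1 then
charge `hcpPeriodicConfiguration a₀ h₀` with positive density frequently in `N` — item 2911's statement `GroundStatesChargePeriodic`
(verbatim the end of `palmToHinge_proof` / `stub_chargeFromLaw`). -/
theorem stub_chargeFromFunnelLaw :
    GoodLawOfZeroDefects →
    (∀ δ : ℝ, 0 < δ → ∀ P : Measure (Measure (EuclideanSpace ℝ (Fin 3))), IsProbabilityMeasure P →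
      (∀ᵐ μ ∂P, IsRootedHardCore δ μ) → IsPointStationaryLaw P →
      (∫ μ, (∫ y, lennardJones ‖y‖ ∂μ) / 2 ∂P) ≤
        (⨅ Q : PeriodicConfiguration 3, Q.energyPerParticle lennardJones) →
      (∀ᵐ μ ∂P, ∃ S : Set (EuclideanSpace ℝ (Fin 3)),
        μ = (Measure.count : Measure (EuclideanSpace ℝ (Fin 3))).restrict S ∧ ∀ y ∈ S, SetGood S y) →
      ∀ᵐ μ ∂P, ∃ a h : ℝ, ∃ ha : a ≠ 0, ∃ hh : h ≠ 0, 1 / 2 ≤ a ∧ a ≤ 2 ∧ 1 / 2 ≤ h ∧ h ≤ 2 ∧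
        ∃ A : EuclideanSpace ℝ (Fin 3) ≃ₗᵢ[ℝ] EuclideanSpace ℝ (Fin 3),
          (hcpPeriodicConfiguration ha hh).energyPerParticle lennardJones =
            (⨅ Q : PeriodicConfiguration 3, Q.energyPerParticle lennardJones) ∧
          μ = (Measure.count : Measure (EuclideanSpace ℝ (Fin 3))).restrict (A '' hcpStacking a h)) →
    (∀ x : (N : ℕ) → (Fin N → EuclideanSpace ℝ (Fin 3)), (∀ N, IsGroundState lennardJones (x N)) →
      ZeroDefectsAlong x) →
    PalmUnimodularRigidity.GroundStatesChargePeriodic := by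
  intro h1 hFR hZ x hx
  obtain ⟨φ, δ, P, hφ, hδ, hP, hcore, hstat, hE, htr, hgood⟩ := h1 x hx (hZ x hx)
  -- Step 1: the good limit law is minimising
  have hLim : PalmUnimodularRigidity.CrysEnergyLimit := PalmUnimodularRigidity.CrysEnergyLimit_holds
  have hlim' : Tendsto (fun j : ℕ => groundStateEnergy lennardJones 3 (φ j) / (φ j : ℝ)) atTop
      (𝓝 (⨅ Q : PeriodicConfiguration 3, Q.energyPerParticle lennardJones)) :=
    hLim.comp hφ.tendsto_atTop
  have hEq := tendsto_nhds_unique hE hlim'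
  -- Step 2: funnel law rigidity — a.s. an exact rotated relaxed hcp crystal
  have hae := hFR δ hδ P hP hcore hstat hEq.le hgood
  -- Step 3: support point + density transfer (verbatim the end of `palmToHinge_proof`)
  set K : Set (ℝ × ℝ) := Icc (1 / 2 : ℝ) 2 ×ˢ Icc (1 / 2 : ℝ) 2 with hKdef
  have hK : IsCompact K := isCompact_Icc.prod isCompact_Icc
  set p : Measure (EuclideanSpace ℝ (Fin 3)) → ℝ × ℝ → Prop := fun μ z =>
    (1 / 2 ≤ z.1 ∧ z.1 ≤ 2 ∧ 1 / 2 ≤ z.2 ∧ z.2 ≤ 2) ∧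
      ∃ A : EuclideanSpace ℝ (Fin 3) ≃ₗᵢ[ℝ] EuclideanSpace ℝ (Fin 3),
        μ = (Measure.count : Measure (EuclideanSpace ℝ (Fin 3))).restrict
          (A '' hcpStacking z.1 z.2)
    with hpdef
  have hae' : ∀ᵐ μ ∂P, ∃ z ∈ K, p μ z := by
    filter_upwards [hae] with μ hμ
    obtain ⟨a, h, _, _, h1, h2, h3, h4, A, -, hμ⟩ := hμ
    exact ⟨(a, h), ⟨⟨h1, h2⟩, ⟨h3, h4⟩⟩, ⟨h1, h2, h3, h4⟩, A, hμ⟩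
  haveI : NeZero P := ⟨IsProbabilityMeasure.ne_zero P⟩
  obtain ⟨⟨a₀, h₀⟩, hzK, hsupp⟩ := exists_mem_forall_nhds_measure_ne_zero P hK p hae'
  obtain ⟨⟨ha₀, ha₀'⟩, ⟨hh₀, hh₀'⟩⟩ := hzK
  have ha₀0 : a₀ ≠ 0 := by intro h0; rw [h0] at ha₀; norm_num at ha₀
  have hh₀0 : h₀ ≠ 0 := by intro h0; rw [h0] at hh₀; norm_num at hh₀
  refine ⟨hcpPeriodicConfiguration ha₀0 hh₀0, ?_⟩
  intro R ε hR hε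
  set η : ℝ := ε / (4 * (R + ε)) with hηdef
  have hRε : 0 < R + ε := by positivity
  have hηpos : 0 < η := by positivity
  have hηRε : 4 * η * (R + ε) ≤ ε := by
    rw [hηdef]; field_simp; exact le_rfl
  set T : Set (Measure (EuclideanSpace ℝ (Fin 3))) :=
    {μ | ∃ z ∈ Metric.ball ((a₀, h₀) : ℝ × ℝ) η, p μ z} with hTdef
  have hT : P T ≠ 0 := hsupp _ (Metric.ball_mem_nhds _ hηpos)
  have hTreal : 0 < (P T).toReal := ENNReal.toReal_pos hT (measure_ne_top P T)
  refine ⟨(P T).toReal / 2, half_pos hTreal, ?_⟩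
  have hev := htr T (R + ε) (ε / 2) (half_pos hε) ((P T).toReal / 2) (half_lt_self hTreal)
  set good : (N : ℕ) → Fin N → Prop := fun N i =>
    ∃ A : EuclideanSpace ℝ (Fin 3) →ₗᵢ[ℝ] EuclideanSpace ℝ (Fin 3),
      ∃ q ∈ (hcpPeriodicConfiguration ha₀0 hh₀0).points,
      (∀ s ∈ (hcpPeriodicConfiguration ha₀0 hh₀0).points, dist s q ≤ R →
        ∃ j : Fin N, dist (x N j) (x N i + A (s - q)) ≤ ε) ∧
      (∀ j : Fin N, dist (x N j) (x N i) ≤ R →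
        ∃ s ∈ (hcpPeriodicConfiguration ha₀0 hh₀0).points, dist (x N j) (x N i + A (s - q)) ≤ ε)
    with hgood_def
  have himp : ∀ (N : ℕ) (i : Fin N),
      (∃ ν ∈ T, ((∀ p : EuclideanSpace ℝ (Fin 3), ν {p} ≠ 0 → ‖p‖ ≤ R + ε →
          ∃ q ∈ (Set.range (fun k : Fin N => x N k - x N i)), dist q p ≤ ε / 2) ∧
        (∀ q ∈ (Set.range (fun k : Fin N => x N k - x N i)), ‖q‖ ≤ R + ε →
          ∃ p : EuclideanSpace ℝ (Fin 3), ν {p} ≠ 0 ∧ dist q p ≤ ε / 2))) → good N i := by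
    rintro N i ⟨ν, ⟨⟨a, h⟩, hz, ⟨ha, ha', hh, hh'⟩, A, rfl⟩, h1, h2⟩
    rw [Metric.mem_ball, Prod.dist_eq, max_lt_iff, Real.dist_eq, Real.dist_eq] at hz
    have h1' : ∀ p : EuclideanSpace ℝ (Fin 3), p ∈ A '' hcpStacking a h → ‖p‖ ≤ R + ε →
        ∃ q ∈ Set.range (fun k : Fin N => x N k - x N i), dist q p ≤ ε / 2 := fun p hp =>
      h1 p ((count_restrict_singleton_ne_zero_iff _ p).2 hp)
    have h2' : ∀ q ∈ Set.range (fun k : Fin N => x N k - x N i), ‖q‖ ≤ R + ε →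
        ∃ p : EuclideanSpace ℝ (Fin 3), p ∈ A '' hcpStacking a h ∧ dist q p ≤ ε / 2 :=
      fun q hq hqn => (h2 q hq hqn).imp fun p hp =>
        ⟨(count_restrict_singleton_ne_zero_iff _ p).1 hp.1, hp.2⟩
    obtain ⟨c1, c2⟩ := matched_hcp_of_matched_near ha₀ hh₀ ha hh hηpos.le hz.1.le hz.2.le hε.le
      hηRε A (x N) i h1' h2'
    refine ⟨A.toLinearIsometry, 0, ?_, ?_, ?_⟩
    · rw [hcpPeriodicConfiguration_points]; exact zero_mem_hcpStacking a₀ h₀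
    · rw [hcpPeriodicConfiguration_points]; exact c1
    · rw [hcpPeriodicConfiguration_points]; exact c2
  have hev' : ∀ᶠ j : ℕ in atTop,
      (P T).toReal / 2 * ((φ j : ℕ) : ℝ) ≤ (Nat.card {i : Fin (φ j) // good (φ j) i} : ℝ) := by
    filter_upwards [hev] with j hj
    refine hj.trans ?_
    exact_mod_cast Nat.card_le_card_of_injective _
      (Subtype.map_injective (fun i hi => himp (φ j) i hi) Function.injective_id)
  exact hφ.tendsto_atTop.frequently
    (p := fun N : ℕ => (P T).toReal / 2 * (N : ℝ) ≤ (Nat.card {i : Fin N // good N i} : ℝ))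
    hev'.frequently

end Summit.AtomisticToContinuum.Crystallization.Theorems.PalmGoodLaw.ChargeFromFunnelLaw

end
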